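import Summits.ResolutionOfSingularities.ResolutionOfSingularities.Theorems.EquisingularLiftEquisingularLiftNatEmbeddedLiftNose
import Summits.ResolutionOfSingularities.ResolutionOfSingularities.Theorems.EquisingularLiftEquisingularLiftNatNoseThenPointsIntrinsic
import HarnessLib

/-!
# [OURS · L1 W4.5(b)] EL♮ helper — T-LIFT part C: the RUNG «H¹(𝒩) = 0 NOSE, THEN POINTS» ⇒ `ELNatAt`
# (non-complete-intersection analogue of the v6 rung `stub_elnat_ciNoseThenPoints`; CONDITIONAL on Hartshorne DT Thm. 22.3)

Cell res-hironaka, LADDER-RESOLUTION rung L (D-0089), slot W4.5(b), crux `Theses.EquisingularLift.EquisingularLiftNat`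
(stmt-ResolutionOfSingularities-20038) and its `n = 3` child `EquisingularLiftNatThree` (stmt-ResolutionOfSingularities-20148);
territory of the v6 research stub `stub_elnat_three_nonisolated_nonci` («non-CI double curves: LIFT₃ frontier / DT 22.3.1;
res-type-027 T-LIFT typing DT 22.3», lead-2 CENSUS 2026-08-27T08:54:47Z); `--supports stmt-ResolutionOfSingularities-20148 --as helper`.
NOT a statement of any manuscript; OURS. AI-written; AI review is weaker than expert review.

COMPOSITION. res-type-051's (5) T-NOSE-THEN-POINTS in intrinsic form (`Sections.elNatBody_of_noseThenPoints_intrinsic`,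
…NatNoseThenPointsIntrinsic.lean) asks for (a) a NOSE `C ⊂ ℙ^N_O` with `V(C) → Spec O` SMOOTH, `supp(C|_{ℙ^N_k}) ⊆ ι_H(H)`,
`ι_H(H) ⊄ supp(C|_{ℙ^N_k})`, and (b′) a point resolution of some blow-up of `H` along `C|_{ℙ^N_k} · 𝒪_H`. T-LIFT supplies (a) from
a SMOOTH closed `S ↪ ℙ^N_k` with `S ⊆ H`, `H ⊄ S`, `H¹(S, 𝒩_{S/ℙ^N}) = 0`: the embedded lift `D` of `S` (`exists_liftsEmbedded_of_normalH1`,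
conditional on `Deformation.Hartshorne2010_thm_22_3`) is smooth over `O` (`LiftsEmbedded.smooth`, part B) with `D|_{ℙ^N_k} = 𝓘_S`
(`LiftsEmbedded.comap_eq`), so (b′) is a hypothesis on the blow-up of `H` along `𝓘_S · 𝒪_H = ι_S.ker.comap ι_H`.

CONTENT. `EmbeddedLift.LiftsEmbedded.coe_support_comap` (`supp(D|_{ℙ^N_k}) = range ι_S`); `Sections.elNatOver_of_normalH1NoseThenPoints`,
`Sections.elNatAt_of_normalH1NoseThenPoints` — EL♮ at `H` (`Theorems.EquisingularLift.ELNatOver` / `ELNatAt`, p503491) from: `k`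
algebraically closed of char `p`; `O` a complete DVR, `CharZero`, algebraically closed residue field, `π : O → k` onto (e.g. `W(k)`);
the named fact; `S` smooth with `H¹(S,𝒩)=0`, `S ⊆ H ⊄ S`; (b′). All sorry-free, standard axioms; the only non-kernel input is the
named published theorem, carried as the explicit hypothesis `h22`.

References: parts A/B `…NatEmbeddedLift.lean`, `…NatEmbeddedLiftNose.lean`; `…NatNoseThenPointsIntrinsic.lean` (res-type-051);
[Hartshorne2010, §22 Thm. 22.3]; Liu 2002 §8.1 (via the cited files) — OURS, index only.
-/

set_option linter.dupNamespace false -- mandated namespace `Summit.<Summit>.<Problem>` of this single-conjunct summit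

noncomputable section

open CategoryTheory CategoryTheory.Limits AlgebraicGeometry TopologicalSpace
open MvPolynomial
open AlgebraicGeometry.Scheme.IdealSheafData

attribute [local instance] MvPolynomial.gradedAlgebra

namespace Summit.ResolutionOfSingularities.ResolutionOfSingularities.Cruxes.EquisingularLiftNat

namespace EmbeddedLift

open Literature.AlgebraicGeometry.Resolution

section NoseThenPoints

variable {O k : Type} [CommRing O] [CommRing k] {N : ℕ}
  {φ : (homogeneousSubmodule (Fin (N + 1)) O) →+*ᵍ (homogeneousSubmodule (Fin (N + 1)) k)}
  {hφ' : HomogeneousIdeal.irrelevant (homogeneousSubmodule (Fin (N + 1)) k) ≤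
    (HomogeneousIdeal.irrelevant (homogeneousSubmodule (Fin (N + 1)) O)).map φ}
  {S : Scheme.{0}} {ι : S ⟶ Proj (homogeneousSubmodule (Fin (N + 1)) k)}
  {D : (Proj (homogeneousSubmodule (Fin (N + 1)) O)).IdealSheafData}

/-- The support of the special fibre of an embedded lift is `range ι` (`ι` a closed immersion): the set-level companion of
`LiftsEmbedded.comap_eq`, in the «`Λ.support`» currency of `elNatBody_of_noseThenPoints_intrinsic`. [folklore] -/
theorem LiftsEmbedded.coe_support_comap [IsClosedImmersion ι] (h : LiftsEmbedded φ hφ' ι D) :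
    ((D.comap (Proj.map φ hφ')).support : Set (Proj (homogeneousSubmodule (Fin (N + 1)) k))) = Set.range ι := by
  rw [h.comap_eq, Scheme.Hom.support_ker, ι.isClosedEmbedding.isClosed_range.closure_eq]

end NoseThenPoints

end EmbeddedLift

namespace Sections

open Literature.AlgebraicGeometry.Resolution EmbeddedLift

/-- **`ELNatOver` FROM «H¹(𝒩) = 0 NOSE, THEN POINTS»** — the non-complete-intersection analogue of the v6 rung
`stub_elnat_ciNoseThenPoints`, CONDITIONAL on the named fact [Hartshorne2010, Thm. 22.3]
(`Deformation.Hartshorne2010_thm_22_3`): `k` algebraically closed of characteristic `p`, `H ↪ ℙ^N_k` integral, `S ↪ ℙ^N_k` a SMOOTH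
closed subscheme with `S ⊆ H`, `H ⊄ S` and `H¹(S, 𝒩_{S/ℙ^N}) = 0`; `O` a complete DVR of characteristic `0` with algebraically closed
residue field and `π : O → k` onto. DOWNSTAIRS HYPOTHESIS (b′) as in `elNatBody_of_noseThenPoints_intrinsic` (res-type-051): some
blow-up `Z → H` of `H` along the trace ideal `𝓘_S · 𝒪_H = ι_S.ker.comap ι_H` is resolved by finitely many point blow-ups at
non-regular closed points (PtChain ∃-form for `(Z, univ)`). THEN `ELNatOver p k N H ι_H O π`: the NOSE is the embedded `O`-lift `D`
of `S` (`exists_liftsEmbedded_of_normalH1`), smooth over `O` (`LiftsEmbedded.smooth`), and (5) T-NOSE-THEN-POINTS (intrinsic form,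
res-type-051) does the rest. [folklore] -/
theorem elNatOver_of_normalH1NoseThenPoints {p : ℕ} (k : Type) [Field k] [CharP k p] [IsAlgClosed k] (N : ℕ) (H : Scheme.{0})
    (ιH : H ⟶ (Literature.AlgebraicGeometry.Motives.projectiveSpace N k).left) [IsClosedImmersion ιH] [IsIntegral H]
    (O : Type) [CommRing O] [IsDomain O] [IsDiscreteValuationRing O] [CharZero O]
    [IsAdicComplete (IsLocalRing.maximalIdeal O) O] [IsAlgClosed (IsLocalRing.ResidueField O)]
    (π : O →+* k) (hπ : Function.Surjective π)
    (h22 : Literature.AlgebraicGeometry.Deformation.Hartshorne2010_thm_22_3.{0}) (hp : p.Prime)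
    {S : Scheme.{0}} (ι : S ⟶ Proj (homogeneousSubmodule (Fin (N + 1)) k)) [IsClosedImmersion ι]
    (hS : Smooth (ι ≫ (Proj.toSpecZero (homogeneousSubmodule (Fin (N + 1)) k) ≫
        Spec.map (CommRingCat.ofHom (algebraMap k ((homogeneousSubmodule (Fin (N + 1)) k) 0))))))
    (hH1 : Subsingleton (Literature.AlgebraicGeometry.HodgeTheory.normalSheafCohomology ι 1))
    (hSH : Set.range ι ⊆ Set.range ιH) (hH : ¬ Set.range ιH ⊆ Set.range ι)
    (hdown : ∃ (Z : Scheme.{0}) (ρ : Z ⟶ H), IsBlowup ρ (ι.ker.comap ιH) ∧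
      ∃ (F' : Scheme.{0}) (ρ' : F' ⟶ Z) (T' : Set F'),
        (∀ Q : (∀ F₁ : Scheme.{0}, (F₁ ⟶ Z) → Set F₁ → Prop), Q Z (𝟙 Z) Set.univ →
          (∀ (F₁ F₃ : Scheme.{0}) (ρ₁ : F₁ ⟶ Z) (T₁ : Set F₁)
            (x : ↥(vanishingIdeal (⟨closure T₁, isClosed_closure⟩ : Closeds F₁)).subscheme) (υ₁ : F₃ ⟶ F₁)
            (hx : IsClosed ({((vanishingIdeal (⟨closure T₁, isClosed_closure⟩ : Closeds F₁)).subschemeι x : F₁)} : Set F₁)),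
            Q F₁ ρ₁ T₁ →
            ¬ IsRegularLocalRing ((vanishingIdeal (⟨closure T₁, isClosed_closure⟩ : Closeds F₁)).subscheme.presheaf.stalk x) →
            IsBlowup υ₁ (vanishingIdeal
              (⟨{((vanishingIdeal (⟨closure T₁, isClosed_closure⟩ : Closeds F₁)).subschemeι x : F₁)}, hx⟩ : Closeds F₁)) →
            Q F₃ (υ₁ ≫ ρ₁) (closure (υ₁ ⁻¹' (T₁ \
              {((vanishingIdeal (⟨closure T₁, isClosed_closure⟩ : Closeds F₁)).subschemeι x : F₁)})))) →
          Q F' ρ' T') ∧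
        Scheme.IsRegular (vanishingIdeal (⟨closure T', isClosed_closure⟩ : Closeds F')).subscheme) :
    Theorems.EquisingularLift.ELNatOver p k N H ιH O π := by
  intro φ hφ' hφ Y hY
  let ιH' : H ⟶ Proj (homogeneousSubmodule (Fin (N + 1)) k) := ιH
  haveI : IsClosedImmersion ιH' := ‹IsClosedImmersion ιH›
  obtain ⟨D, hD⟩ := exists_liftsEmbedded_of_normalH1 π hπ φ hφ hφ' ι h22 hp hS hH1
  have hsuppS := hD.coe_support_comap
  exact elNatBody_of_noseThenPoints_intrinsic O k π hπ N H ιH' φ hφ' hφ D (hD.smooth π hπ hφ hS)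
    (by rw [hsuppS]; exact hH) (by rw [hsuppS]; exact hSH) (by rw [hD.comap_eq]; exact hdown) Y hY

/-- **`ELNatAt` FROM «H¹(𝒩) = 0 NOSE, THEN POINTS»** — packaged with `elNatAt_of_elNatOver`: EL♮ holds at an integral
`H ↪ ℙ^N_k` whose chosen smooth `S ⊆ H` (`H ⊄ S`) has `H¹(S, 𝒩) = 0` and whose blow-up along `𝓘_S · 𝒪_H` is point-resolvable
downstairs — CONDITIONAL on [Hartshorne2010, Thm. 22.3], over any complete DVR `O` of characteristic `0` with algebraically closed
residue field mapping onto `k` (e.g. `W(k)`). [folklore] -/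
theorem elNatAt_of_normalH1NoseThenPoints {p : ℕ} (k : Type) [Field k] [CharP k p] [IsAlgClosed k] (N : ℕ) (H : Scheme.{0})
    (ιH : H ⟶ (Literature.AlgebraicGeometry.Motives.projectiveSpace N k).left) [IsClosedImmersion ιH] [IsIntegral H]
    (O : Type) [CommRing O] [IsDomain O] [IsDiscreteValuationRing O] [CharZero O]
    [IsAdicComplete (IsLocalRing.maximalIdeal O) O] [IsAlgClosed (IsLocalRing.ResidueField O)]
    (π : O →+* k) (hπ : Function.Surjective π)
    (h22 : Literature.AlgebraicGeometry.Deformation.Hartshorne2010_thm_22_3.{0}) (hp : p.Prime)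
    {S : Scheme.{0}} (ι : S ⟶ Proj (homogeneousSubmodule (Fin (N + 1)) k)) [IsClosedImmersion ι]
    (hS : Smooth (ι ≫ (Proj.toSpecZero (homogeneousSubmodule (Fin (N + 1)) k) ≫
        Spec.map (CommRingCat.ofHom (algebraMap k ((homogeneousSubmodule (Fin (N + 1)) k) 0))))))
    (hH1 : Subsingleton (Literature.AlgebraicGeometry.HodgeTheory.normalSheafCohomology ι 1))
    (hSH : Set.range ι ⊆ Set.range ιH) (hH : ¬ Set.range ιH ⊆ Set.range ι)
    (hdown : ∃ (Z : Scheme.{0}) (ρ : Z ⟶ H), IsBlowup ρ (ι.ker.comap ιH) ∧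
      ∃ (F' : Scheme.{0}) (ρ' : F' ⟶ Z) (T' : Set F'),
        (∀ Q : (∀ F₁ : Scheme.{0}, (F₁ ⟶ Z) → Set F₁ → Prop), Q Z (𝟙 Z) Set.univ →
          (∀ (F₁ F₃ : Scheme.{0}) (ρ₁ : F₁ ⟶ Z) (T₁ : Set F₁)
            (x : ↥(vanishingIdeal (⟨closure T₁, isClosed_closure⟩ : Closeds F₁)).subscheme) (υ₁ : F₃ ⟶ F₁)
            (hx : IsClosed ({((vanishingIdeal (⟨closure T₁, isClosed_closure⟩ : Closeds F₁)).subschemeι x : F₁)} : Set F₁)),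
            Q F₁ ρ₁ T₁ →
            ¬ IsRegularLocalRing ((vanishingIdeal (⟨closure T₁, isClosed_closure⟩ : Closeds F₁)).subscheme.presheaf.stalk x) →
            IsBlowup υ₁ (vanishingIdeal
              (⟨{((vanishingIdeal (⟨closure T₁, isClosed_closure⟩ : Closeds F₁)).subschemeι x : F₁)}, hx⟩ : Closeds F₁)) →
            Q F₃ (υ₁ ≫ ρ₁) (closure (υ₁ ⁻¹' (T₁ \
              {((vanishingIdeal (⟨closure T₁, isClosed_closure⟩ : Closeds F₁)).subschemeι x : F₁)})))) →
          Q F' ρ' T') ∧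
        Scheme.IsRegular (vanishingIdeal (⟨closure T', isClosed_closure⟩ : Closeds F')).subscheme) :
    Theorems.EquisingularLift.ELNatAt p k N H ιH :=
  Theorems.EquisingularLift.elNatAt_of_elNatOver hπ
    (elNatOver_of_normalH1NoseThenPoints k N H ιH O π hπ h22 hp ι hS hH1 hSH hH hdown)

end Sections

end Summit.ResolutionOfSingularities.ResolutionOfSingularities.Cruxes.EquisingularLiftNat

end
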